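import Summits.BirchSwinnertonDyer.BirchSwinnertonDyer.Theorems.EisensteinPrimesCharResidualSelmerFinite
import Summits.BirchSwinnertonDyer.BirchSwinnertonDyer.Theorems.EisensteinPrimesKummerTorsionH1
import Summits.BirchSwinnertonDyer.BirchSwinnertonDyer.Theorems.EisensteinPrimesUnramifiedLineSelmerClasses
import HarnessLib

/-!
# Towards Keller–Yin Lemma 1.2.4 in the `K_∞`-currency (`H¹_{𝓕_nr}^{S₀}(K_∞, 𝔽(θ̄)) ≅ H¹_{𝓕_nr}^{S₀}(K_∞, (F/𝒪)(θ))[p]`):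
# the KUMMER BIJECTION `H¹(G, 𝔽(θ̄)) ≅ H¹(G, (F/𝒪)(θ))[p]` for every group `G` acting through `Γ_K`
# (cell `bsd-eis`, seat `bsd-line-x1-p1` LEAD g3, D-0154 KEY row 4; crux 2 `GoodLatticeBDPValue`
# stmt-BirchSwinnertonDyer-19032, line `halves` v19.1, stub `stub_imprimLambda` = KY Thm. 1.4.1 (iii), V20 road brick (b))

HONEST FRAMING (cell `bsd-eis`, run/shared/lean/pub/bsd-eis/): Galois-cohomology bookkeeping; no definition, no
named fact, no `sorry`, no `Theses` import; nothing about BSD / IMC2 / KY Thm. 1.4.1 (iii) is proved. Helper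
`--supports stmt-BirchSwinnertonDyer-19032`; closes no registered stub.

## What
For `θ : Γ_K → GL₁(𝓞)` with `θ^{p−1} = 1`, `B = (F/𝒪)(θ)` (`charModule ∅ θ ≅ ℚ_p/ℤ_p(θ)`), an equivariant embedding
`j : A ↪ B` onto `B[p]` (`A ≅ 𝔽(θ̄)`), `H = ker κ` for ANY `ℤ_p`-extension `κ`, ANY `v̄` and ANY `S₀`:
* §1 `exists_resH1Hom_id_eq_of_nsmul_eq_zero` — KUMMER SURJECTIVITY: every `p`-torsion class of `H¹(G, B)`
  is `j_*` of a class of `H¹(G, A)`, for any topological group `G` acting continuously (cohomology sequence of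
  `0 → A → B —p→ B → 0`, `B` `p`-divisible; tree `IsSES.exists_map_one_eq_of_map_one_eq_zero`).
* §2 `resH1Hom_id_injective_charModule_of_hom` — KUMMER INJECTIVITY for every group `G` acting on `A`, `B`
  THROUGH a homomorphism `G → Γ_K` (inertia / decomposition groups of `K_∞` are such): p634599's dichotomy
  (`θ|_G = 1`, or some `θ(g) − 1 ∈ ℤ_p^×`) verbatim.
* NEXT FILE (brick (b) part 2, successor): `natCard_unrSelmer_residual_eq` —
  `#H¹_{𝓕_nr}^{S₀}(K_∞, A) = #{s ∈ H¹_{𝓕_nr}^{S₀}(K_∞, B) | p s = 0}`: `j_*` is a bijection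
  `H¹(K_∞, A) ≅ H¹(K_∞, B)[p]` (§1 + p634599 §3) which respects every local condition of `unrSelmer κ · v̄ S₀` in
  both directions, because each condition is the kernel of a restriction to a subgroup acting through `Γ_K`
  (inertia groups off `S₀ ∪ {w ∣ p}`, `mem_unramifiedOutside_iff`, naturality `res_inertiaIn_comp_resH1Hom_id`;
  Greenberg's condition of the strict datum at `v̄` = unramified at `v̄`, `unramifiedKer_le_greenbergKer` and the
  `M ⧸ ⊥` iso; no condition at the other places above `p`, `greenbergKer_relaxedDatum_eq_top`) on which `j_*` is
  injective by §2 — NO hypothesis on `S₀` or on `θ` at `v̄` («their assumption `θ|_{G_v̄} ≠ 1` is not essential»,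
  KY proof of Lemma 1.2.4). With brick (a) (`CharDualExactCount`, p639105) it reads
  `#H¹_{𝓕_nr}^{S₀}(K_∞, 𝔽(θ̄)) = p^{λ(𝔛^{S₀}_θ)} · #𝔛^{S₀}_θ[p]`.

References: [KellerYin2024] Lemma 1.2.4 (arXiv:2402.12781v2 TeX L720–778); [CastellaGrossiLeeSkinner2022] Lemma 13
(arXiv:2008.02571 §1.2); [SerreGaloisCohomology1997] I.§2.2; [MilneADT2006] I Lemma 2.9.
-/

set_option autoImplicit false
set_option linter.dupNamespace false -- the summit namespace `…BirchSwinnertonDyer.BirchSwinnertonDyer.Theorems` (Sub = Summit, D-0017) trips it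

noncomputable section

open scoped Classical

universe u

namespace Summit.BirchSwinnertonDyer.BirchSwinnertonDyer.Theorems.CharResidualKummerIso

open CategoryTheory Function NumberField IsDedekindDomain Field
open Literature.NumberTheory.EllipticCurves Literature.NumberTheory.EllipticCurves.GreenbergSelmer
  Literature.NumberTheory.EllipticCurves.GreenbergVatsal2000 Literature.NumberTheory.GaloisRepresentations
  Literature.NumberTheory.EllipticCurves.KellerYin2024 Literature.NumberTheory.IwasawaTheory
  Summit.BirchSwinnertonDyer.BirchSwinnertonDyer.Theorems.CharResidualSelmerFinite

/-! ### §1 Kummer surjectivity `H¹(G, A) ↠ H¹(G, B)[p]` -/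

section Surj

variable {G : Type u} [Group G] [TopologicalSpace G] [IsTopologicalGroup G]
variable {A : Type u} [AddCommGroup A] [DistribMulAction G A] [TopologicalSpace A] [DiscreteTopology A]
variable {B : Type u} [AddCommGroup B] [DistribMulAction G B] [TopologicalSpace B] [DiscreteTopology B]

/-- **Kummer surjectivity**: for an exact `0 → A —j→ B —p→ B → 0` of discrete `G`-modules with continuous
orbit maps (`j` equivariant and injective with image the `p`-torsion, `B` `p`-divisible), every class
`c ∈ H¹(G, B)` with `p c = 0` is `j_* c'` for some `c' ∈ H¹(G, A)` (exactness of
`H¹(G, A) → H¹(G, B) —p→ H¹(G, B)`). [cite: SerreGaloisCohomology1997, I.§2.2 (Prop. 2)] [cite: MilneADT2006, I §2 Lemma 2.9] -/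
theorem exists_resH1Hom_id_eq_of_nsmul_eq_zero {p : ℕ} (j : A →+ B)
    (hj : ∀ (g : G) (a : A), j (ContinuousMonoidHom.id G g • a) = g • j a) (hinj : Function.Injective j)
    (hrange : ∀ x : B, x ∈ j.range ↔ p • x = 0) (hdiv : ∀ b : B, ∃ b' : B, p • b' = b)
    (hcontA : ∀ a : A, Continuous fun g : G ↦ g • a) (hcontB : ∀ b : B, Continuous fun g : G ↦ g • b)
    (c : discreteH1 G B) (hc : p • c = 0) :
    ∃ c' : discreteH1 G A, resH1Hom (ContinuousMonoidHom.id G) j hj c' = c := by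
  have hj' : ∀ (g : G) (a : A), j (g • a) = g • j a := hj
  -- the continuous representations (definitionally `discreteTopRep`)
  let ρA : ContinuousRep G ℤ A :=
    { toRepresentation := (discreteContRep G A).toRepresentation
      continuous_smul := continuous_prod_of_discrete_right.mpr hcontA }
  let ρB : ContinuousRep G ℤ B :=
    { toRepresentation := (discreteContRep G B).toRepresentation
      continuous_smul := continuous_prod_of_discrete_right.mpr hcontB }
  have hρA : ρA.toTopRep = discreteTopRep G A := rfl
  have hρB : ρB.toTopRep = discreteTopRep G B := rfl
  -- `j` and multiplication by `p` as morphisms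
  let f : ρA.toTopRep ⟶ ρB.toTopRep :=
    TopRep.ofHom ⟨⟨j.toIntLinearMap, continuous_of_discreteTopology⟩, fun σ ↦ by
      ext a; exact hj' σ a⟩
  have hf : ∀ a : A, f.hom a = j a := fun _ ↦ rfl
  let g : ρB.toTopRep ⟶ ρB.toTopRep :=
    TopRep.ofHom
      { toLinearMap :=
          { toFun := fun b ↦ p • b
            map_add' := fun a b ↦ nsmul_add a b p
            map_smul' := fun c a ↦ by
              change p • (c • a) = c • (p • a)
              exact smul_comm p c a }
        cont := continuous_of_discreteTopology
        isIntertwining' := fun σ ↦ by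
          refine ContinuousLinearMap.ext fun a ↦ ?_
          change p • ρB.toTopRep.ρ σ a = ρB σ (p • a)
          rw [ContinuousRep.toTopRep_ρ_apply, map_nsmul] }
  have hg : ∀ b : B, g.hom b = p • b := fun _ ↦ rfl
  have hSES : IsSES f g :=
    { comp_eq_zero := by
        ext a
        change p • j a = 0
        exact (hrange (j a)).mp ⟨a, rfl⟩
      injective := hinj
      exact_mid := fun y hy ↦ by
        obtain ⟨a, ha⟩ := (hrange y).mpr hy
        exact ⟨a, ha⟩
      surjective := fun b ↦ hdiv b }
  have hpc : cohomologyMap g 1 c = 0 := by rw [cohomologyMap_one_eq_nsmul ρB g p hg]; exact hc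
  obtain ⟨y, hy⟩ := hSES.exists_map_one_eq_of_map_one_eq_zero c hpc
  -- `cohomologyMap f 1 = j_*` on classes
  obtain ⟨φ, rfl⟩ := oneCocycleClass_surjective ρA.toTopRep y
  refine ⟨oneCocycleClass (discreteTopRep G A) φ, ?_⟩
  rw [resH1Hom_id_oneCocycleClass, ← hy, cohomologyMap_oneCocycleClass]
  exact congrArg (oneCocycleClass (discreteTopRep G B)) (Subtype.ext (ContinuousMap.ext fun _ ↦ rfl))

end Surj

/-! ### §2 Kummer injectivity for a group acting through `Γ_K` -/

section Inj

variable {K : Type} [Field K] {p : ℕ} [hp : Fact p.Prime]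
  (θ : FramedGaloisRep K (padicCoeffIntegers (∅ : Set (PadicAlgCl p))) 1)
  {G : Type} [Group G] [TopologicalSpace G] [IsTopologicalGroup G]
  {A : Type} [AddCommGroup A] [DistribMulAction (absoluteGaloisGroup K) A] [DistribMulAction G A]
  [TopologicalSpace A] [DiscreteTopology A] [DistribMulAction G (charModule (∅ : Set (PadicAlgCl p)) θ)]

omit [TopologicalSpace G] [IsTopologicalGroup G] [TopologicalSpace A] [DiscreteTopology A] in
/-- **The coboundary-lift property for the character module, for `G` acting through `φ : G → Γ_K`**
(p634599's `coboundary_lift_charModule` verbatim with `φ` inserted): either `θ ∘ φ = 1` and coboundaries of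
`B` vanish, or some `θ(φ g) − 1` is a unit and a `p`-torsion coboundary `∂b` has `b ∈ B[p] = j(A)`.
[cite: KellerYin2024, Lemma 1.2.4 (arXiv:2402.12781v2 TeX L760–778)] [cite: CastellaGrossiLeeSkinner2022, Lemma 13] -/
theorem coboundary_lift_charModule_of_hom (hθ : ∀ σ : absoluteGaloisGroup K, θ σ ^ (p - 1) = 1)
    (φ : G →* absoluteGaloisGroup K) (hφA : ∀ (g : G) (a : A), g • a = φ g • a)
    (hφB : ∀ (g : G) (b : charModule (∅ : Set (PadicAlgCl p)) θ), g • b = φ g • b)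
    (j : A →+ charModule (∅ : Set (PadicAlgCl p)) θ)
    (hj : ∀ (σ : absoluteGaloisGroup K) (a : A), j (σ • a) = σ • j a)
    (hrange : ∀ x : charModule (∅ : Set (PadicAlgCl p)) θ, x ∈ j.range ↔ p • x = 0)
    (b : charModule (∅ : Set (PadicAlgCl p)) θ) (hb : ∀ g : G, g • b - b ∈ j.range) :
    ∃ a : A, ∀ g : G, g • b - b = j (g • a - a) := by
  by_cases htriv : ∀ g : G, unitChar θ (φ g) = 1
  · refine ⟨0, fun g ↦ ?_⟩
    have hfix : φ g • b = b := by
      obtain ⟨z, rfl⟩ := (charModuleEquiv θ).symm.surjective b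
      rw [galois_smul_charModuleEquiv_symm, htriv g, Units.val_one, one_smul]
    rw [smul_zero, sub_zero, map_zero, hφB, hfix, sub_self]
  · obtain ⟨g₀, hg₀⟩ := not_forall.mp htriv
    have hupow : ((unitChar θ (φ g₀) : ℤ_[p]ˣ) : ℤ_[p]) ^ (p - 1) = 1 := by
      rw [← Units.val_pow_eq_pow_val, unitChar_pow_eq_one θ hθ, Units.val_one]
    have hu1 : ((unitChar θ (φ g₀) : ℤ_[p]ˣ) : ℤ_[p]) ≠ 1 := fun h ↦ hg₀ (Units.ext h)
    have hunit := isUnit_sub_one_of_pow_sub_one_eq_one_of_ne_one hupow hu1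
    have hpA : ∀ x : charModule (∅ : Set (PadicAlgCl p)) θ, x ∈ j.range → p • x = 0 :=
      fun x hx ↦ (hrange x).mp hx
    have hpb : ∀ g : G, φ g • (p • b) = p • b := by
      intro g
      have h0 : p • (g • b - b) = 0 := hpA _ (hb g)
      rw [hφB, smul_sub, sub_eq_zero, smul_comm] at h0
      exact h0
    have hpb0 : p • b = 0 := by
      obtain ⟨z, hz⟩ := (charModuleEquiv θ).symm.surjective (p • b)
      have h := hpb g₀
      rw [← hz, galois_smul_charModuleEquiv_symm] at h
      have h' := (charModuleEquiv θ).symm.injective h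
      have hz0 : z = 0 := by
        have e : (((unitChar θ (φ g₀) : ℤ_[p]ˣ) : ℤ_[p]) - 1) • z = 0 := by
          rw [sub_smul, one_smul, h', sub_self]
        exact (hunit.smul_eq_zero).mp e
      rw [← hz, hz0, map_zero]
    obtain ⟨a, rfl⟩ : b ∈ j.range := (hrange b).mpr hpb0
    refine ⟨a, fun g ↦ ?_⟩
    rw [map_sub, hφB, hφA, hj]

/-- **Kummer injectivity for `G` acting through `Γ_K`**: `j_* : H¹(G, A) → H¹(G, (F/𝒪)(θ))` is injective.
[cite: KellerYin2024, Lemma 1.2.4 (arXiv:2402.12781v2)] [cite: CastellaGrossiLeeSkinner2022, Lemma 13] -/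
theorem resH1Hom_id_injective_charModule_of_hom (hθ : ∀ σ : absoluteGaloisGroup K, θ σ ^ (p - 1) = 1)
    (φ : G →* absoluteGaloisGroup K) (hφA : ∀ (g : G) (a : A), g • a = φ g • a)
    (hφB : ∀ (g : G) (b : charModule (∅ : Set (PadicAlgCl p)) θ), g • b = φ g • b)
    (j : A →+ charModule (∅ : Set (PadicAlgCl p)) θ)
    (hj : ∀ (σ : absoluteGaloisGroup K) (a : A), j (σ • a) = σ • j a) (hinj : Function.Injective j)
    (hrange : ∀ x : charModule (∅ : Set (PadicAlgCl p)) θ, x ∈ j.range ↔ p • x = 0)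
    (hjG : ∀ (g : G) (a : A), j (ContinuousMonoidHom.id G g • a) = g • j a) :
    Function.Injective (resH1Hom (ContinuousMonoidHom.id G) j hjG) :=
  resH1Hom_id_injective_of_coboundary_lift (G := G) j hjG hinj
    (coboundary_lift_charModule_of_hom θ hθ φ hφA hφB j hj hrange)

end Inj

end Summit.BirchSwinnertonDyer.BirchSwinnertonDyer.Theorems.CharResidualKummerIso

end
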